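import Summits.BirchSwinnertonDyer.BirchSwinnertonDyer.Theorems.DefiniteThetaDerivedHeightCapIwasawaSerreAnyField
import Literature.NumberTheory.EllipticCurves.IwasawaMuLambdaDefinitions
import HarnessLib

/-!
# `μ(θ^{ac}) = 0` forces a FINITE order of vanishing: `ord_J θ^{ac} ≤ λ(L_f) < ∞`

Route-independent `Theorems` file (cell `b2b-bsdres`, seat `b2b-bsdres-x10b`, gen 46), part 21 of the series «tower square root»
serving crux `DerivedHeightCap` (stmt-BirchSwinnertonDyer-18438, route DefiniteTheta) — and useful to its sibling crux
`DefiniteExactOrder` (stmt-18437), which needs UPPER bounds for `T.acOrderOfVanishing`.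
HONEST FRAMING: no curve asserted, no class closed, BSD not proved by any of this.

With the Iwasawa power series `L` of `θ^{ac}` (parts 19–20: `ord_J θ^{ac} = ord_X L`, `HasMuZeroAc ↔ p ∤ L`) and the tree's `μ`/`λ` of a power
series (`Literature.NumberTheory.EllipticCurves.MuLambda.mu / lam`, Greenberg–Vatsal (1)–(2)):

* §1 power series: `red_eq_zero_iff_C_dvd` (`L ≡ 0 (mod p) ⟺ p ∣ L`), `mu_eq_zero_of_not_C_dvd`, `not_C_dvd_iff_ne_zero_and_mu_eq_zero`,
  `pfree_eq_self_of_not_C_dvd`, `order_le_lam_of_not_C_dvd` (**`p ∤ L ⇒ ord_X L ≤ λ(L)`**: reduction mod `p` only raises the order),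
  `order_lt_top_of_not_C_dvd`;
* §2 ★ `acOrderOfVanishing_lt_top_of_hasMuZeroAc`: **for EVERY number field `K`, every prime `p` and every norm-compatible tower, `μ(θ^{ac}) = 0`
  (`T.HasMuZeroAc`, Vatsal / Pollack–Weston Thm. 2.3 for the tower) implies `T.acOrderOfVanishing p φ α < ⊤`** — `θ^{ac}` does not vanish to
  every order; ★ `acOrderOfVanishing_le_lam` (`K` imaginary quadratic, generator system `d`, `L` the power series of part 19):
  **`μ = 0 ⇒ ord_J θ^{ac} ≤ λ(L)`**, and `hasMuZeroAc_iff_mu` (`HasMuZeroAc ↔ L ≠ 0 ∧ μ(L) = 0`).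

## References
* [BertoliniDarmon2005] §1.2 (18)–(21); [PollackWeston2011] §2.3, Thm. 2.3; [Vatsal2003] Thm. 1.1; [GreenbergVatsal2000] (1)–(2);
  [Washington1997] §7.1.
-/

noncomputable section

open scoped BigOperators Polynomial

-- D-0017: single-problem summit, the namespace repeats the problem name by design.
set_option linter.dupNamespace false

namespace Summit.BirchSwinnertonDyer.BirchSwinnertonDyer.Theorems.TowerSqrt

open Literature.NumberTheory.EllipticCurves Literature.NumberTheory.EllipticCurves.QuadOrderTower NumberField
  Literature.NumberTheory.Automorphic Module
open Literature.NumberTheory.EllipticCurves.MuLambda (red mu pfree lam C_pow_mu_dvd bddAbove_setOf_C_pow_dvd)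

universe u

variable (p : ℕ) [hp : Fact p.Prime]

/-! ### §1 `p ∤ L`: `μ(L) = 0`, `pfree L = L`, `ord_X L ≤ λ(L) < ∞` -/

/-- `L ≡ 0 (mod p)` (coefficientwise) iff `p ∣ L` in `ℤ_p⟦X⟧`. [cite: GreenbergVatsal2000, p. 2, (2)] -/
theorem red_eq_zero_iff_C_dvd (L : IwasawaAlgebra p) : red L = 0 ↔ (PowerSeries.C (p : ℤ_[p]) : PowerSeries ℤ_[p]) ∣ L := by
  rw [C_dvd_iff_forall_dvd_coeff, PowerSeries.ext_iff]
  refine forall_congr' fun k => ?_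
  rw [PowerSeries.coeff_map, map_zero, IsLocalRing.residue_eq_zero_iff, PadicInt.maximalIdeal_eq_span_p, Ideal.mem_span_singleton]

/-- `p ∤ L ⇒ μ(L) = 0`. [cite: GreenbergVatsal2000, p. 2, (2)] -/
theorem mu_eq_zero_of_not_C_dvd {L : IwasawaAlgebra p} (h : ¬ (PowerSeries.C (p : ℤ_[p]) : PowerSeries ℤ_[p]) ∣ L) : mu L = 0 := by
  have hset : {n : ℕ | PowerSeries.C ((p : ℤ_[p]) ^ n) ∣ L} = {0} := by
    ext n
    simp only [Set.mem_setOf_eq, Set.mem_singleton_iff]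
    constructor
    · intro hn
      by_contra h0
      apply h
      obtain ⟨m, rfl⟩ := Nat.exists_eq_succ_of_ne_zero h0
      rw [pow_succ, map_mul] at hn
      exact (dvd_mul_left _ _).trans hn
    · rintro rfl
      simp
  rw [mu, hset, csSup_singleton]

/-- `p ∤ L` iff `L ≠ 0` and `μ(L) = 0` (for `L ≠ 0`, `p ∣ L` forces `1 ≤ μ(L)`). [cite: GreenbergVatsal2000, p. 2, (2)] -/
theorem not_C_dvd_iff_ne_zero_and_mu_eq_zero (L : IwasawaAlgebra p) :
    ¬ (PowerSeries.C (p : ℤ_[p]) : PowerSeries ℤ_[p]) ∣ L ↔ L ≠ 0 ∧ mu L = 0 := by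
  constructor
  · intro h
    refine ⟨?_, mu_eq_zero_of_not_C_dvd p h⟩
    rintro rfl
    exact h (dvd_zero _)
  · rintro ⟨hL, hmu⟩ hdvd
    have h1 : (1 : ℕ) ≤ mu L := le_csSup (bddAbove_setOf_C_pow_dvd hL) (by simpa using hdvd)
    omega

/-- `p ∤ L ⇒ pfree L = L` (`L = p^{μ(L)} · pfree L` with `μ(L) = 0`). [cite: GreenbergVatsal2000, p. 2, (2)] -/
theorem pfree_eq_self_of_not_C_dvd {L : IwasawaAlgebra p} (h : ¬ (PowerSeries.C (p : ℤ_[p]) : PowerSeries ℤ_[p]) ∣ L) : pfree L = L := by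
  have hL : L ≠ 0 := ((not_C_dvd_iff_ne_zero_and_mu_eq_zero p L).mp h).1
  have hspec : L = PowerSeries.C ((p : ℤ_[p]) ^ mu L) * pfree L := by
    rw [pfree, dif_neg hL]
    exact Classical.choose_spec (C_pow_mu_dvd hL)
  rw [mu_eq_zero_of_not_C_dvd p h, pow_zero, map_one, one_mul] at hspec
  exact hspec.symm

/-- **`p ∤ L ⇒ ord_X L ≤ λ(L)`**: `λ(L)` is the order of `L mod p`, and reduction mod `p` can only raise the `X`-adic order; `L mod p ≠ 0`, so
that order is finite. [cite: GreenbergVatsal2000, p. 2–3, (1)–(2)] -/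
theorem order_le_lam_of_not_C_dvd {L : IwasawaAlgebra p} (h : ¬ (PowerSeries.C (p : ℤ_[p]) : PowerSeries ℤ_[p]) ∣ L) :
    L.order ≤ (lam L : ℕ∞) := by
  have hred : red L ≠ 0 := fun h0 => h ((red_eq_zero_iff_C_dvd p L).mp h0)
  rw [lam, pfree_eq_self_of_not_C_dvd p h, PowerSeries.coe_toNat_order hred]
  exact PowerSeries.le_order_map _

/-- `p ∤ L ⇒ ord_X L < ⊤`. [folklore] -/
theorem order_lt_top_of_not_C_dvd {L : IwasawaAlgebra p} (h : ¬ (PowerSeries.C (p : ℤ_[p]) : PowerSeries ℤ_[p]) ∣ L) :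
    L.order < ⊤ :=
  lt_of_le_of_lt (order_le_lam_of_not_C_dvd p h) (ENat.coe_lt_top _)

/-! ### §2 The tower: `μ(θ^{ac}) = 0 ⇒ ord_J θ^{ac} ≤ λ(L_f) < ∞` -/

/-- ★ **`μ(θ^{ac}) = 0` forces a finite order of vanishing** — for EVERY number field `K`, every prime `p` and every tower of Gross points with
norm-compatible theta elements: if some coefficient of `θ_n^{ac}` is a unit for all large `n` (`T.HasMuZeroAc`, Vatsal's `μ = 0` for the
tower) then `θ^{ac}` does not vanish to every order, `T.acOrderOfVanishing p φ α < ⊤` (`ord_J θ^{ac} = ord_X L ≤ λ(L)`, part 20 + §1).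
[cite: PollackWeston2011, §2.3] [cite: BertoliniDarmon2005, §1.2 (18)–(21)] -/
theorem acOrderOfVanishing_lt_top_of_hasMuZeroAc :
    ∀ (K : Type) [Field K] [NumberField K] (p : ℕ) [Fact p.Prime] (Nplus Nminus : ℕ) (S : Brandt.XiSetup Nplus Nminus)
      (T : GrossPointTower K S p) (φ : Brandt.ClassSet S.O → ℤ) (α : ℤ_[p]ˣ), T.IsNormCompatible p φ α → T.HasMuZeroAc p φ α →
      T.acOrderOfVanishing p φ α < ⊤ := by
  intro K _ _ p _ Nplus Nminus S T φ α hnc hmu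
  obtain ⟨L, hord, -, hmuL, -⟩ := exists_powerSeries_acOrderOfVanishing_eq_order_anyField K p Nplus Nminus S T φ α hnc
  rw [hord]
  exact order_lt_top_of_not_C_dvd p (hmuL.mp hmu)

/-- Hence, under `μ = 0`, `θ^{ac}` fails to vanish to SOME finite order `ρ + 1`: a finite-level certificate `θ_n^{ac} ∉ I^{ρ+1}` exists.
[cite: PollackWeston2011, §2.3] -/
theorem exists_not_vanishesToOrderAc_of_hasMuZeroAc :
    ∀ (K : Type) [Field K] [NumberField K] (p : ℕ) [Fact p.Prime] (Nplus Nminus : ℕ) (S : Brandt.XiSetup Nplus Nminus)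
      (T : GrossPointTower K S p) (φ : Brandt.ClassSet S.O → ℤ) (α : ℤ_[p]ˣ), T.IsNormCompatible p φ α → T.HasMuZeroAc p φ α →
      ∃ ρ n : ℕ, T.thetaAc p φ α n ∉ augIdeal ℤ_[p] (AcLayerGroup K p (n + 1)) ^ (ρ + 1) := by
  intro K _ _ p _ Nplus Nminus S T φ α hnc hmu
  have hlt := acOrderOfVanishing_lt_top_of_hasMuZeroAc K p Nplus Nminus S T φ α hnc hmu
  obtain ⟨ρ, hρ⟩ := ENat.ne_top_iff_exists.mp hlt.ne
  refine ⟨ρ, ?_⟩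
  by_contra h
  push Not at h
  have hv : T.VanishesToOrderAc p φ α (ρ + 1) := h
  have := GrossPointTower.le_acOrderOfVanishing hv
  rw [← hρ] at this
  exact absurd (by exact_mod_cast this : ρ + 1 ≤ ρ) (by omega)

variable {K : Type u} [Field K] [NumberField K] {Nplus Nminus : ℕ} {S : Brandt.XiSetup Nplus Nminus}
  (φ : Brandt.ClassSet S.O → ℤ) (α : ℤ_[p]ˣ) (T : GrossPointTower K S p)

-- see part 8
set_option synthInstance.maxHeartbeats 40000 in
/-- `μ` in the tree's `MuLambda` currency: `T.HasMuZeroAc p φ α ↔ L ≠ 0 ∧ μ(L) = 0` for the Iwasawa power series `L` of `θ^{ac}` (part 19).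
[cite: PollackWeston2011, §2.3] [cite: GreenbergVatsal2000, p. 2, (2)] -/
theorem hasMuZeroAc_iff_mu (hK : IsImaginaryQuadratic K)
    (d : ∀ n : ℕ, ClassGroup (quadOrder K (p ^ (n + 1))))
    (hdres : ∀ n, picRes K (pow_dvd_pow p (n + 1).le_succ) (d (n + 1)) = d n)
    (hdgen : ∀ n (x : ClassGroup (quadOrder K (p ^ (n + 1)))), ∃ i : ℕ, x * (d n ^ i)⁻¹ ∈ torsionImage K p (n + 1))
    {L : PowerSeries ℤ_[p]}
    (hL : ∀ n (R : ℤ_[p][X]), ((1 + PowerSeries.X : PowerSeries ℤ_[p]) ^ Nat.card (AcLayerGroup K p (n + 1)) - 1) ∣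
        L - (R : PowerSeries ℤ_[p]) →
      (Polynomial.aeval (R := ℤ_[p]) (MonoidAlgebra.of ℤ_[p] _ (acProj K p (n + 1) (d n)) - 1)) R = T.thetaAc p φ α n) :
    T.HasMuZeroAc p φ α ↔ L ≠ 0 ∧ mu L = 0 :=
  (hasMuZeroAc_iff_not_C_dvd p φ α T hK d hdres hdgen hL).trans (not_C_dvd_iff_ne_zero_and_mu_eq_zero p L)

-- see part 8
set_option synthInstance.maxHeartbeats 40000 in
/-- ★ **`μ = 0 ⇒ ord_J θ^{ac} ≤ λ(L_f)`** (`K` imaginary quadratic, any prime `p`, `L` the Iwasawa power series of `θ^{ac}` with respect to a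
coherent generator system `d`): the anticyclotomic order of vanishing is at most the `λ`-invariant of `L_f`. [cite: BertoliniDarmon2005, §1.2 (18)–(21)]
[cite: GreenbergVatsal2000, p. 2–3, (1)–(2)] -/
theorem acOrderOfVanishing_le_lam (hK : IsImaginaryQuadratic K)
    (d : ∀ n : ℕ, ClassGroup (quadOrder K (p ^ (n + 1))))
    (hdres : ∀ n, picRes K (pow_dvd_pow p (n + 1).le_succ) (d (n + 1)) = d n)
    (hdgen : ∀ n (x : ClassGroup (quadOrder K (p ^ (n + 1)))), ∃ i : ℕ, x * (d n ^ i)⁻¹ ∈ torsionImage K p (n + 1))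
    {L : PowerSeries ℤ_[p]}
    (hL : ∀ n (R : ℤ_[p][X]), ((1 + PowerSeries.X : PowerSeries ℤ_[p]) ^ Nat.card (AcLayerGroup K p (n + 1)) - 1) ∣
        L - (R : PowerSeries ℤ_[p]) →
      (Polynomial.aeval (R := ℤ_[p]) (MonoidAlgebra.of ℤ_[p] _ (acProj K p (n + 1) (d n)) - 1)) R = T.thetaAc p φ α n)
    (hmu : T.HasMuZeroAc p φ α) : T.acOrderOfVanishing p φ α ≤ (lam L : ℕ∞) := by
  rw [acOrderOfVanishing_eq_order p φ α T hK d hdres hdgen hL]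
  exact order_le_lam_of_not_C_dvd p ((hasMuZeroAc_iff_not_C_dvd p φ α T hK d hdres hdgen hL).mp hmu)

end Summit.BirchSwinnertonDyer.BirchSwinnertonDyer.Theorems.TowerSqrt

end
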